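import Literature.NumberTheory.CubicFields.CubicFieldDiscriminant13971
import HarnessLib

/-!
# The cubic field of discriminant `−13971` (LMFDB 3.1.13971.1), part 2: the primes above `p ≤ 13` are principal — PROVED

Sequel of `CubicFieldDiscriminant13971.lean` (same seat, same namespace `Literature.NumberTheory.CubicFields.CubicDisc13971`; §1–§2 there: the polynomial,
`d_F = −13971`, `𝓞_F = ℤ[θ]`, signature).  THEOREMS ONLY; every statement PROVED.  §3 (first half, this file): the `θ`-relation and every prime of
`𝓞_F` above `p ≤ 13` is principal (explicit generators / inert primes, Dedekind–Kummer); the primes above `13 < p ≤ 33` and §4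
(★ `h_F = 1` by Minkowski, `not_two_dvd_classNumber`) are in the sequel `CubicFieldDiscriminant13971ClassNumber.lean`.  Written by the prover seat `bsd-line-att-p4` g39
(cell `bsd-f1-sign2`; g27/g38 template) for the seed of conductor `13971` of crux C2.

References: [LMFDB] number field 3.1.13971.1 (class number 1); [Marcus2018] Ch. 3 Thm. 27, Ch. 5 Thm. 37 and Cor. 2.
-/

noncomputable section

open Polynomial NumberField NumberField.InfinitePlace Ideal Module Real
open Literature.NumberTheory.NumberFields
open Literature.NumberTheory.NumberFields.MonicCubic

namespace Literature.NumberTheory.CubicFields.CubicDisc13971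

section NumberField

variable {F : Type*} [Field F] [NumberField F] {α : F}

/-! ## §3 The primes of norm `≤ 33` are principal -/

/-- The cubic relation `θ³ + aθ² + bθ + c = 0` in `𝓞_F`, numerals pushed (private helper). [folklore] -/
private theorem theta_rel (hα : aeval α (poly (1) (15) (12)) = 0) :
    thetaInt hα ^ 3 + (1) * thetaInt hα ^ 2 + (15) * thetaInt hα + (12) = 0 := by
  have h := thetaInt_rel hα
  push_cast at h
  linear_combination h

-- PRIME 2
/-- `(2, θ + 0) = (386 + 5 * θ + 26 * θ ^ 2)` (an element of norm `±2`). [cite: Marcus2018, Ch. 3, Thm. 27] -/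
theorem span_2_lin0_eq (hα : aeval α (poly (1) (15) (12)) = 0) :
    span {(2 : 𝓞 F), thetaInt hα} = span {386 + 5 * thetaInt hα + 26 * thetaInt hα ^ 2} := by
  have hrel := theta_rel hα
  apply le_antisymm
  · rw [span_le]
    rintro x hx
    rcases hx with rfl | hx
    · exact mem_span_singleton'.mpr ⟨-5 - 7 * thetaInt hα - thetaInt hα ^ 2, by linear_combination (-161 - 26 * thetaInt hα) * hrel⟩
    · rw [Set.mem_singleton_iff.mp hx]
      exact mem_span_singleton'.mpr ⟨6 + 5 * thetaInt hα - 3 * thetaInt hα ^ 2, by linear_combination (193 - 78 * thetaInt hα) * hrel⟩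
  · rw [span_singleton_le_iff_mem, mem_span_pair]
    exact ⟨163 - 32 * thetaInt hα + 13 * thetaInt hα ^ 2, -6 - 5 * thetaInt hα - 5 * thetaInt hα ^ 2, by linear_combination (-5) * hrel⟩

/-- `(2, θ² + 1θ + 1) = (-5 - 7 * θ - θ ^ 2)` (an element of norm `4`). [cite: Marcus2018, Ch. 3, Thm. 27] -/
theorem span_2_quad_eq (hα : aeval α (poly (1) (15) (12)) = 0) :
    span {(2 : 𝓞 F), thetaInt hα ^ 2 + thetaInt hα + 1} = span {-5 - 7 * thetaInt hα - thetaInt hα ^ 2} := by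
  have hrel := theta_rel hα
  apply le_antisymm
  · rw [span_le]
    rintro x hx
    rcases hx with rfl | hx
    · exact mem_span_singleton'.mpr ⟨386 + 5 * thetaInt hα + 26 * thetaInt hα ^ 2, by linear_combination (-161 - 26 * thetaInt hα) * hrel⟩
    · rw [Set.mem_singleton_iff.mp hx]
      exact mem_span_singleton'.mpr ⟨163 + 2 * thetaInt hα + 11 * thetaInt hα ^ 2, by linear_combination (-68 - 11 * thetaInt hα) * hrel⟩
  · rw [span_singleton_le_iff_mem, mem_span_pair]
    exact ⟨-36 - 79 * thetaInt hα - 40 * thetaInt hα ^ 2, -5 - 6 * thetaInt hα - 6 * thetaInt hα ^ 2, by linear_combination (-6 - 6 * thetaInt hα) * hrel⟩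

/-- **Every prime of `𝓞_F` above `2` is principal** (Dedekind–Kummer with `polyMod_2` and the generators above).
[cite: Marcus2018, Ch. 3, Thm. 27] [cite: LMFDB, number field 3.1.13971.1 (class number 1)] -/
theorem isPrincipal_of_mem_primesOver_2 (h3 : finrank ℚ F = 3) (hα : aeval α (poly (1) (15) (12)) = 0) {P : Ideal (𝓞 F)}
    (hP : P ∈ primesOver (span {((2 : ℕ) : ℤ)}) (𝓞 F)) : Submodule.IsPrincipal P := by
  haveI : Fact (Nat.Prime 2) := ⟨by norm_num⟩
  obtain ⟨Qb, hirr, hmon, hdvd, -, hspan⟩ :=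
    exists_factor_of_mem_primesOver irreducible_polyQ hα h3 isUnit_of_disc_eq_sq_mul (by norm_num : Nat.Prime 2) hP
  rw [polyMod_2] at hdvd
  rcases hirr.prime.dvd_or_dvd hdvd with h | h
  · have hQb : Qb = X := eq_of_monic_of_associated hmon monic_X (hirr.associated_of_dvd irreducible_X h)
    have hPeq := hspan X (by rw [hQb, Polynomial.map_X])
    rw [aeval_X, Nat.cast_ofNat, span_2_lin0_eq hα] at hPeq
    exact ⟨⟨386 + 5 * thetaInt hα + 26 * thetaInt hα ^ 2, by rw [hPeq, Ideal.submodule_span_eq]⟩⟩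
  · have hQb : Qb = X ^ 2 + X + 1 :=
      eq_of_monic_of_associated hmon (by monicity!) (hirr.associated_of_dvd CubicDisc307.irreducible_quad_two h)
    have hPeq := hspan (X ^ 2 + X + 1) (by rw [hQb]; simp)
    rw [show aeval (thetaInt hα) (X ^ 2 + X + 1 : ℤ[X]) = thetaInt hα ^ 2 + thetaInt hα + 1 by
        simp only [map_add, map_pow, aeval_X, map_one], Nat.cast_ofNat, span_2_quad_eq hα] at hPeq
    exact ⟨⟨-5 - 7 * thetaInt hα - thetaInt hα ^ 2, by rw [hPeq, Ideal.submodule_span_eq]⟩⟩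

-- PRIME 3
/-- `(3, θ + 0) = (93 + 149 * θ + 42 * θ ^ 2)` (an element of norm `±3`). [cite: Marcus2018, Ch. 3, Thm. 27] -/
theorem span_3_lin0_eq (hα : aeval α (poly (1) (15) (12)) = 0) :
    span {(3 : 𝓞 F), thetaInt hα} = span {93 + 149 * thetaInt hα + 42 * thetaInt hα ^ 2} := by
  have hrel := theta_rel hα
  apply le_antisymm
  · rw [span_le]
    rintro x hx
    rcases hx with rfl | hx
    · exact mem_span_singleton'.mpr ⟨571491 + 7378 * thetaInt hα + 38497 * thetaInt hα ^ 2, by linear_combination (4429055 + 1616874 * thetaInt hα) * hrel⟩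
    · rw [Set.mem_singleton_iff.mp hx]
      exact mem_span_singleton'.mpr ⟨-153988 - 1988 * thetaInt hα - 10373 * thetaInt hα ^ 2, by linear_combination (-1193407 - 435666 * thetaInt hα) * hrel⟩
  · rw [span_singleton_le_iff_mem, mem_span_pair]
    exact ⟨7 + 21 * thetaInt hα + 14 * thetaInt hα ^ 2, -4 - 6 * thetaInt hα - 6 * thetaInt hα ^ 2, by linear_combination (-6) * hrel⟩

/-- `(3, θ + 1) = (-1 - θ)` (an element of norm `±3`). [cite: Marcus2018, Ch. 3, Thm. 27] -/
theorem span_3_lin1_eq (hα : aeval α (poly (1) (15) (12)) = 0) :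
    span {(3 : 𝓞 F), thetaInt hα + 1} = span {-1 - thetaInt hα} := by
  have hrel := theta_rel hα
  apply le_antisymm
  · rw [span_le]
    rintro x hx
    rcases hx with rfl | hx
    · exact mem_span_singleton'.mpr ⟨-15 - thetaInt hα ^ 2, by linear_combination (1) * hrel⟩
    · rw [Set.mem_singleton_iff.mp hx]
      exact mem_span_singleton'.mpr ⟨-1, by linear_combination ((0 : 𝓞 F)) * hrel⟩
  · rw [span_singleton_le_iff_mem, mem_span_pair]
    exact ⟨-23 - 27 * thetaInt hα + 2 * thetaInt hα ^ 2, -4 - 6 * thetaInt hα - 6 * thetaInt hα ^ 2, by linear_combination (-6) * hrel⟩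

/-- **Every prime of `𝓞_F` above `3` is principal** (Dedekind–Kummer with `polyMod_3` and the generators above).
[cite: Marcus2018, Ch. 3, Thm. 27] [cite: LMFDB, number field 3.1.13971.1 (class number 1)] -/
theorem isPrincipal_of_mem_primesOver_3 (h3 : finrank ℚ F = 3) (hα : aeval α (poly (1) (15) (12)) = 0) {P : Ideal (𝓞 F)}
    (hP : P ∈ primesOver (span {((3 : ℕ) : ℤ)}) (𝓞 F)) : Submodule.IsPrincipal P := by
  haveI : Fact (Nat.Prime 3) := ⟨by norm_num⟩
  obtain ⟨Qb, hirr, hmon, hdvd, -, hspan⟩ :=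
    exists_factor_of_mem_primesOver irreducible_polyQ hα h3 isUnit_of_disc_eq_sq_mul (by norm_num : Nat.Prime 3) hP
  rw [polyMod_3] at hdvd
  rcases hirr.prime.dvd_or_dvd hdvd with h12 | h
  · rcases hirr.prime.dvd_or_dvd h12 with h | h
    · have hQb : Qb = X := eq_of_monic_of_associated hmon monic_X (hirr.associated_of_dvd irreducible_X h)
      have hPeq := hspan X (by rw [hQb, Polynomial.map_X])
      rw [aeval_X, Nat.cast_ofNat, span_3_lin0_eq hα] at hPeq
      exact ⟨⟨93 + 149 * thetaInt hα + 42 * thetaInt hα ^ 2, by rw [hPeq, Ideal.submodule_span_eq]⟩⟩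
    · have hQb : Qb = X := eq_of_monic_of_associated hmon monic_X (hirr.associated_of_dvd irreducible_X h)
      have hPeq := hspan X (by rw [hQb, Polynomial.map_X])
      rw [aeval_X, Nat.cast_ofNat, span_3_lin0_eq hα] at hPeq
      exact ⟨⟨93 + 149 * thetaInt hα + 42 * thetaInt hα ^ 2, by rw [hPeq, Ideal.submodule_span_eq]⟩⟩
  · have hirr1 : Irreducible (X + 1 : (ZMod 3)[X]) := by
      rw [show (X + 1 : (ZMod 3)[X]) = X - C (-1) by rw [map_neg, map_one, sub_neg_eq_add]]
      exact irreducible_X_sub_C _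
    have hQb : Qb = X + 1 := eq_of_monic_of_associated hmon (by monicity!) (hirr.associated_of_dvd hirr1 h)
    have hPeq := hspan (X + 1) (by rw [hQb]; simp)
    rw [show aeval (thetaInt hα) (X + 1 : ℤ[X]) = thetaInt hα + 1 by
        simp only [map_add, aeval_X, map_one], Nat.cast_ofNat, span_3_lin1_eq hα] at hPeq
    exact ⟨⟨-1 - thetaInt hα, by rw [hPeq, Ideal.submodule_span_eq]⟩⟩

-- PRIME 5
/-- **Every prime of `𝓞_F` above `5` is principal**: `5` is inert, the prime is `(5)`. [cite: Marcus2018, Ch. 3, Thm. 27] -/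
theorem isPrincipal_of_mem_primesOver_5 (h3 : finrank ℚ F = 3) (hα : aeval α (poly (1) (15) (12)) = 0) {P : Ideal (𝓞 F)}
    (hP : P ∈ primesOver (span {((5 : ℕ) : ℤ)}) (𝓞 F)) : Submodule.IsPrincipal P := by
  have hPeq := eq_span_of_no_root irreducible_polyQ hα h3 isUnit_of_disc_eq_sq_mul (by norm_num : Nat.Prime 5) hP no_root_5
  exact ⟨⟨((5 : ℕ) : 𝓞 F), by rw [hPeq, Ideal.submodule_span_eq]⟩⟩

-- PRIME 7
/-- `f` has no root modulo `7`: `7` is inert. [cite: Marcus2018, Ch. 3, Thm. 27] -/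
theorem no_root_7' : ∀ r : ZMod 7, r ^ 3 + ((1 : ℤ) : ZMod 7) * r ^ 2 + ((15 : ℤ) : ZMod 7) * r + ((12 : ℤ) : ZMod 7) ≠ 0 := by
  decide

/-- **Every prime of `𝓞_F` above `7` is principal**: `7` is inert, the prime is `(7)`. [cite: Marcus2018, Ch. 3, Thm. 27] -/
theorem isPrincipal_of_mem_primesOver_7 (h3 : finrank ℚ F = 3) (hα : aeval α (poly (1) (15) (12)) = 0) {P : Ideal (𝓞 F)}
    (hP : P ∈ primesOver (span {((7 : ℕ) : ℤ)}) (𝓞 F)) : Submodule.IsPrincipal P := by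
  have hPeq := eq_span_of_no_root irreducible_polyQ hα h3 isUnit_of_disc_eq_sq_mul (by norm_num : Nat.Prime 7) hP no_root_7'
  exact ⟨⟨((7 : ℕ) : 𝓞 F), by rw [hPeq, Ideal.submodule_span_eq]⟩⟩

-- PRIME 11
/-- `(11, θ + 2) = (-1 + 2 * θ + 4 * θ ^ 2)` (an element of norm `±11`). [cite: Marcus2018, Ch. 3, Thm. 27] -/
theorem span_11_lin2_eq (hα : aeval α (poly (1) (15) (12)) = 0) :
    span {(11 : 𝓞 F), thetaInt hα + 2} = span {-1 + 2 * thetaInt hα + 4 * thetaInt hα ^ 2} := by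
  have hrel := theta_rel hα
  apply le_antisymm
  · rw [span_le]
    rintro x hx
    rcases hx with rfl | hx
    · exact mem_span_singleton'.mpr ⟨-3563 - 46 * thetaInt hα - 240 * thetaInt hα ^ 2, by linear_combination (296 - 960 * thetaInt hα) * hrel⟩
    · rw [Set.mem_singleton_iff.mp hx]
      exact mem_span_singleton'.mpr ⟨-386 - 5 * thetaInt hα - 26 * thetaInt hα ^ 2, by linear_combination (32 - 104 * thetaInt hα) * hrel⟩
  · rw [span_singleton_le_iff_mem, mem_span_pair]
    exact ⟨1, -6 + 4 * thetaInt hα, by linear_combination ((0 : 𝓞 F)) * hrel⟩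

/-- **Every prime of `𝓞_F` above `11` with `11^f ≤ 33` is principal** (Dedekind–Kummer with `polyMod_11` and the generators above).
[cite: Marcus2018, Ch. 3, Thm. 27] [cite: LMFDB, number field 3.1.13971.1 (class number 1)] -/
theorem isPrincipal_of_mem_primesOver_11 (h3 : finrank ℚ F = 3) (hα : aeval α (poly (1) (15) (12)) = 0) {P : Ideal (𝓞 F)}
    (hP : P ∈ primesOver (span {((11 : ℕ) : ℤ)}) (𝓞 F))
    (hle : 11 ^ P.inertiaDeg ℤ ≤ 33) : Submodule.IsPrincipal P := by
  haveI : Fact (Nat.Prime 11) := ⟨by norm_num⟩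
  obtain ⟨Qb, hirr, hmon, hdvd, hdeg, hspan⟩ :=
    exists_factor_of_mem_primesOver irreducible_polyQ hα h3 isUnit_of_disc_eq_sq_mul (by norm_num : Nat.Prime 11) hP
  rw [polyMod_11] at hdvd
  rcases hirr.prime.dvd_or_dvd hdvd with h | h
  · have hirr1 : Irreducible (X + 2 : (ZMod 11)[X]) := by
      rw [show (X + 2 : (ZMod 11)[X]) = X - C (-2) by rw [map_neg, map_ofNat]; ring]
      exact irreducible_X_sub_C _
    have hQb : Qb = X + 2 := eq_of_monic_of_associated hmon (by monicity!) (hirr.associated_of_dvd hirr1 h)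
    have hPeq := hspan (X + C 2) (by rw [hQb]; simp [map_ofNat])
    rw [show aeval (thetaInt hα) (X + C 2 : ℤ[X]) = thetaInt hα + 2 by
        simp only [map_add, aeval_X, aeval_C, algebraMap_int_eq, Int.coe_castRingHom, Int.cast_ofNat], Nat.cast_ofNat, span_11_lin2_eq hα] at hPeq
    exact ⟨⟨-1 + 2 * thetaInt hα + 4 * thetaInt hα ^ 2, by rw [hPeq, Ideal.submodule_span_eq]⟩⟩
  · have hQb : Qb = X ^ 2 + 10 * X + 6 :=
      eq_of_monic_of_associated hmon (by monicity!) (hirr.associated_of_dvd irreducible_quad_11 h)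
    exfalso
    have hd2 : (X ^ 2 + 10 * X + 6 : (ZMod 11)[X]).natDegree = 2 := by compute_degree!
    rw [hdeg, hQb, hd2] at hle
    norm_num at hle

-- PRIME 13
/-- `f` has no root modulo `13`: `13` is inert. [cite: Marcus2018, Ch. 3, Thm. 27] -/
theorem no_root_13' : ∀ r : ZMod 13, r ^ 3 + ((1 : ℤ) : ZMod 13) * r ^ 2 + ((15 : ℤ) : ZMod 13) * r + ((12 : ℤ) : ZMod 13) ≠ 0 := by
  decide

/-- **Every prime of `𝓞_F` above `13` is principal**: `13` is inert, the prime is `(13)`. [cite: Marcus2018, Ch. 3, Thm. 27] -/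
theorem isPrincipal_of_mem_primesOver_13 (h3 : finrank ℚ F = 3) (hα : aeval α (poly (1) (15) (12)) = 0) {P : Ideal (𝓞 F)}
    (hP : P ∈ primesOver (span {((13 : ℕ) : ℤ)}) (𝓞 F)) : Submodule.IsPrincipal P := by
  have hPeq := eq_span_of_no_root irreducible_polyQ hα h3 isUnit_of_disc_eq_sq_mul (by norm_num : Nat.Prime 13) hP no_root_13'
  exact ⟨⟨((13 : ℕ) : 𝓞 F), by rw [hPeq, Ideal.submodule_span_eq]⟩⟩

end NumberField

end Literature.NumberTheory.CubicFields.CubicDisc13971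

end
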